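import Summits.QuantumAdvantage.QuantumAdvantage.Theorems.SosSandwichTransferPBPerFamilyFinal
import HarnessLib

/-!
# `BQP^{A[O(1)]} ⊆ AvgP^A` almost surely from `PromiseBQP ⊆ PromiseBPP'` ALONE — the bounded-query transfer, unconditionally

Route `SosSandwich`; support for the hypothesis-type crux `RandomOracleHeurSeparation` (stmt-QuantumAdvantage-1131) and the
analytic crux `PseudoBoundedAA` (stmt-15237).  The random-oracle transfer of the route (`AA_Q → PromiseBQP ⊆ PromiseBPP' →
∀ᵐ A, BQP^A ⊆ AvgP^A`) needs the quantum-query influence conjecture only to make the influence threshold polynomial in the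
number of oracle gates; for families with a CONSTANT bound `T₀` on that number the proved Dinur–Friedgut–Kindler–O'Donnell
bound suffices (`SimTreePB.oracleSimulationAt_of_boundedQueries`, per-family chain).  This file restricts the two glue theorems
to a CLASS of families (proofs verbatim twins: `ae_subset_AvgPRel_of_apxMachinesOn` of the Literature
`ae_BQPRel_subset_AvgPRel_of_apxMachines`, `ae_subset_AvgPRel_of_simulationOn` of `ae_BQPRel_subset_AvgPRel_of_simulation`) and
concludes **`ae_boundedQuery_subset_AvgPRel`** / `ae_forall_boundedQuery_subset_AvgPRel`: given `PromiseBQP ⊆ PromiseBPP'`, almost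
surely every language decided relative to `A` by a uniform Clifford+T oracle family with `O(1)` oracle queries is in `AvgP^A`
— the constant-query shadow of AA14 Thm. 26, with NO conjecture.  Honest label: the hypothesis `PromiseBQP ⊆ PromiseBPP'` is
believed false; the theorem is a transfer statement (what a promise collapse would dequantize relative to random oracles).
Sources: AaronsonAmbainis2014 Thm. 23, Thm. 26; DinurEtAl2007 Thm. 3; BennettGill1981 Thm. 5.
-/

-- D-0017: single-conjunct summit ⇒ the duplicate `QuantumAdvantage.QuantumAdvantage` is mandated.
set_option linter.dupNamespace false

noncomputable section

namespace Summit.QuantumAdvantage.QuantumAdvantage.Theorems.SosSandwich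

open MeasureTheory Filter Literature.Computability.Complexity Literature.Computability.Cryptography
  Literature.Computability.QuantumComplexity Literature.Barriers.QuantumAdvantage
open Summit.QuantumAdvantage.QuantumAdvantage.Theses.SosSandwich
open Summit.QuantumAdvantage.QuantumAdvantage.Cruxes.TransferPB.Birth
open scoped ENNReal

namespace TransferPBGlue

/-- **The probabilistic half of Thm. 23, restricted to a class of families** (twin of the Literature theorem
`ae_BQPRel_subset_AvgPRel_of_apxMachines`, proof verbatim with the countable index set `{F // F.IsUniform ∧ P F}`): (apx)-machines
for the uniform families of the class give, almost surely, `AvgP^A`-membership of every language they decide relative to `A`.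
[cite: AaronsonAmbainis2014, Thm. 23 (proof, p. 14)] -/
theorem ae_subset_AvgPRel_of_apxMachinesOn (P : QCircuitFamily cliffordT → Prop)
    (h : ∀ F : QCircuitFamily cliffordT, F.IsUniform → P F →
      ∃ (C : OracleAlg Bool) (q : Polynomial ℕ), C.IsPolyTime Computability.encodingBoolBool ∧
        (∀ (A : Language Bool) (x : List Bool),
          ∀ y ∈ C.queries (Oracle.ofLanguage A) (q.eval x.length) x, y.length ≤ q.eval x.length) ∧
        ∀ x : List Bool, 1 ≤ x.length →
          randomOracleMeasure (badEvent F C q x) < ENNReal.ofReal (1 / (x.length : ℝ) ^ 3)) :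
    ∀ᵐ A ∂randomOracleMeasure,
      {L : Language Bool | ∃ F : QCircuitFamily cliffordT, F.IsUniform ∧ P F ∧
          ∀ x, (x ∈ L → 2 / 3 ≤ F.acceptProbOn (A : Language Bool) x) ∧ (x ∉ L → F.acceptProbOn A x ≤ 1 / 3)} ⊆
        Literature.Barriers.QuantumAdvantage.AvgPRel (Oracle.ofLanguage (A : Language Bool)) := by
  have hex : ∀ Fu : {F : QCircuitFamily cliffordT // F.IsUniform ∧ P F},
      ∃ (C : OracleAlg Bool) (q : Polynomial ℕ), C.IsPolyTime Computability.encodingBoolBool ∧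
        (∀ (A : Language Bool) (x : List Bool),
          ∀ y ∈ C.queries (Oracle.ofLanguage A) (q.eval x.length) x, y.length ≤ q.eval x.length) ∧
        ∀ x : List Bool, 1 ≤ x.length →
          randomOracleMeasure (badEvent Fu.1 C q x) < ENNReal.ofReal (1 / (x.length : ℝ) ^ 3) :=
    fun Fu => h Fu.1 Fu.2.1 Fu.2.2
  choose C q hpoly hquery hapx using hex
  haveI : Countable {F : QCircuitFamily cliffordT // F.IsUniform ∧ P F} :=
    (Literature.Computability.QuantumComplexity.countable_setOf_isUniform.mono fun F (hF : F ∈ {F : QCircuitFamily cliffordT | F.IsUniform ∧ P F}) => hF.1).to_subtype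
  have hae : ∀ᵐ A ∂randomOracleMeasure, ∀ Fu : {F : QCircuitFamily cliffordT // F.IsUniform ∧ P F},
      ∀ᶠ n in atTop, n * badCount Fu.1 (C Fu) (q Fu) n A < 2 ^ n := by
    rw [ae_all_iff]
    exact fun Fu => ae_eventually_few_bad Fu.1 (C Fu) (q Fu) (hapx Fu)
  filter_upwards [hae] with A hA
  rintro L ⟨F, hU, hP, hprom⟩
  set Fu : {F : QCircuitFamily cliffordT // F.IsUniform ∧ P F} := ⟨F, hU, hP⟩ with hFu
  refine ⟨C Fu, hpoly Fu, q Fu, fun x => hquery Fu A x, ?_⟩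
  -- squeeze the error fraction between `0` and `1/n`
  refine tendsto_of_tendsto_of_tendsto_of_le_of_le' tendsto_const_nhds
    tendsto_one_div_atTop_nhds_zero_nat (Eventually.of_forall fun n =>
      Literature.Barriers.QuantumAdvantage.errFraction_nonneg _ _ _) ?_
  filter_upwards [hA Fu, eventually_ge_atTop 1] with n hn hn1
  refine (errFraction_le_badCount F (C Fu) (q Fu) hprom n).trans ?_
  rw [div_le_div_iff₀ (by positivity) (by exact_mod_cast hn1), one_mul]
  have : ((n * badCount F (C Fu) (q Fu) n A : ℕ) : ℝ) < ((2 ^ n : ℕ) : ℝ) := by exact_mod_cast hn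
  push_cast at this
  linarith

/-- **The glue, restricted to a class of families** (twin of `ae_BQPRel_subset_AvgPRel_of_simulation`, proof verbatim):
promise-oracle simulation of the uniform families IN THE CLASS `P` + elimination of a promise-BPP' oracle +
`PromiseBQP ⊆ PromiseBPP'` ⟹ almost surely every language decided with bounded error by a uniform family of the class,
relative to `A`, lies in `AvgP^A`. [cite: AaronsonAmbainis2014, Thm. 23 (proof, p. 14)] -/
theorem ae_subset_AvgPRel_of_simulationOn (P : QCircuitFamily cliffordT → Prop)
    (h₁ : ∀ F₀ : QCircuitFamily cliffordT, P F₀ → F₀.IsUniform → ∀ r : Polynomial ℕ,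
        ∃ Q ∈ Literature.Computability.Cryptography.PromiseBQP, ∃ (C : OracleAlg Bool) (q : Polynomial ℕ),
          C.IsPolyTime Computability.encodingBoolBool ∧
          (∀ (O : Oracle) (x : List Bool), ∀ y ∈ C.queries O (q.eval x.length) x, y.length ≤ q.eval x.length) ∧
          ∀ x : List Bool, 1 ≤ x.length → ∀ g : List Bool → Bool,
            (∀ v ∈ Q.yes, g v = true) → (∀ v ∈ Q.no, g v = false) →
            (ProbabilityTheory.setBernoulli (Set.univ : Set (List Bool)) ⟨1 / 2, by norm_num, by norm_num⟩)
              {A : Set (List Bool) |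
                (2 / 3 ≤ F₀.acceptProbOn A x ∧
                  C.run (Oracle.ofLanguage {w : List Bool | ∃ v : List Bool, (w = false :: v ∧ v ∈ A) ∨
                    (w = true :: v ∧ g v = true)}) (q.eval x.length) x ≠ some true) ∨
                (F₀.acceptProbOn A x ≤ 1 / 3 ∧
                  C.run (Oracle.ofLanguage {w : List Bool | ∃ v : List Bool, (w = false :: v ∧ v ∈ A) ∨
                    (w = true :: v ∧ g v = true)}) (q.eval x.length) x ≠ some false)}
              ≤ ENNReal.ofReal (1 / (((r.eval x.length : ℕ) : ℝ) + 1)))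
    (h₂ : Sig.stub_promiseOracleElimination)
    (hPr : Literature.Computability.Cryptography.PromiseBQP ⊆ Literature.Computability.Complexity.PromiseBPP') :
    ∀ᵐ A ∂randomOracle,
      {L : Language Bool | ∃ F : QCircuitFamily cliffordT, F.IsUniform ∧ P F ∧
          ∀ x, (x ∈ L → 2 / 3 ≤ F.acceptProbOn (A : Language Bool) x) ∧ (x ∉ L → F.acceptProbOn A x ≤ 1 / 3)} ⊆
        Literature.Computability.Complexity.AvgPRel (Oracle.ofLanguage (A : Language Bool)) := by
  have key : ∀ᵐ A ∂randomOracleMeasure,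
      {L : Language Bool | ∃ F : QCircuitFamily cliffordT, F.IsUniform ∧ P F ∧
          ∀ x, (x ∈ L → 2 / 3 ≤ F.acceptProbOn (A : Language Bool) x) ∧ (x ∉ L → F.acceptProbOn A x ≤ 1 / 3)} ⊆
        Literature.Barriers.QuantumAdvantage.AvgPRel (Oracle.ofLanguage (A : Language Bool)) := by
    refine ae_subset_AvgPRel_of_apxMachinesOn P fun F hU hP => ?_
    -- polynomial size of the uniform family (width bound)
    obtain ⟨pF, hpF⟩ := QCircuitFamily.IsUniform.isPolySize' hU
    -- stub 2 with error polynomial `4 X³`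
    obtain ⟨Q, hQ, C, q, hCpoly, hCq, hC⟩ := h₁ F hP hU (4 * Polynomial.X ^ 3)
    -- the hypothesis of `TransferPB` moves `Q` into `PromiseBPP'`
    have hQ' : Q ∈ PromiseBPP' := hPr hQ
    -- stub 3 with the short horizon `ℓ = X + pF + q` and error polynomial `2 X³`
    obtain ⟨C', q', hC'poly, hC'q, hC'⟩ :=
      h₂ Q hQ' C q hCpoly hCq (Polynomial.X + pF + q) (2 * Polynomial.X ^ 3)
    refine ⟨C', q', hC'poly, hC'q, fun x hx => ?_⟩
    obtain ⟨V, ĝ, hVfar, hĝloc, hrun, hincons⟩ := hC' x hx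
    -- notation: the short horizon `L = ℓ(n) = n + pF(n) + q(n)` and the short window `S`
    set L : ℕ := (Polynomial.X + pF + q).eval x.length with hL
    have hLeval : L = x.length + pF.eval x.length + q.eval x.length := by
      simp [hL, Polynomial.eval_add, Polynomial.eval_X]
    set S : Finset (List Bool) := shortStrings (L + 1) with hS
    have hwidth : x.length + F.ancillas x.length ≤ L + 1 := by
      have := (hpF x.length).2; rw [hLeval]; omega
    have hqL : q.eval x.length ≤ L + 1 := by rw [hLeval]; omega
    have hdet : ∀ g, IsDetermined S (badWith F C q x g) := fun g =>
      isDetermined_badWith F C q x g hwidth (fun O => hCq O x) hqL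
    -- `V` misses the short window
    have hVS : ∀ v ∈ V, v ∉ S := fun v hv hvS => by
      have h1 := hVfar v hv; have h2 := mem_shortStrings.1 hvS; omega
    -- the two covering events
    set B₁ : Set (Set (List Bool)) := {A | ¬ ((∀ v ∈ Q.yes, ĝ A v = true) ∧ (∀ v ∈ Q.no, ĝ A v = false))} with hB₁
    set B₂ : Set (Set (List Bool)) := {A | ((∀ v ∈ Q.yes, ĝ A v = true) ∧ (∀ v ∈ Q.no, ĝ A v = false)) ∧ A ∈ badWith F C q x (ĝ A)} with hB₂
    have hsub : badEvent F C' q' x ⊆ B₁ ∪ B₂ := by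
      intro A hA
      by_cases hc : ((∀ v ∈ Q.yes, ĝ A v = true) ∧ (∀ v ∈ Q.no, ĝ A v = false))
      · refine Or.inr ⟨hc, ?_⟩
        rcases hA with ⟨hp, hne⟩ | ⟨hp, hne⟩
        · exact Or.inl ⟨hp, fun heq => hne (hrun A true heq)⟩
        · exact Or.inr ⟨hp, fun heq => hne (hrun A false heq)⟩
      · exact Or.inl hc
    -- bound on `B₁`: stub 3
    have hB₁le : randomOracleMeasure B₁ ≤
        ENNReal.ofReal (1 / ((((2 * Polynomial.X ^ 3 : Polynomial ℕ).eval x.length : ℕ) : ℝ) + 1)) :=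
      hincons
    -- `ĝ` ignores the short window
    have hĝpatch : ∀ (A₀ : Set (List Bool)) (w : S → Bool), ĝ (patchFin A₀ S w) = ĝ A₀ := by
      intro A₀ w
      rw [hĝloc (patchFin A₀ S w), hĝloc A₀]
      congr 1
      ext s
      simp only [Set.mem_inter_iff, Finset.mem_coe]
      constructor
      · rintro ⟨hs, hsV⟩; exact ⟨(mem_patchFin_of_not_mem w (hVS s hsV)).1 hs, hsV⟩
      · rintro ⟨hs, hsV⟩; exact ⟨(mem_patchFin_of_not_mem w (hVS s hsV)).2 hs, hsV⟩
    -- `B₂` is determined by the finite set `S ∪ V`, hence measurable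
    have hB₂det : IsDetermined (S ∪ V) B₂ := by
      intro A A' h
      have hSA : restrictBool S A = restrictBool S A' := funext fun u => by
        have := congrFun h ⟨u.1, Finset.mem_union_left V u.2⟩
        simpa only [restrictBool_apply] using this
      have hVA : A ∩ ↑V = A' ∩ ↑V := by
        ext s
        simp only [Set.mem_inter_iff, Finset.mem_coe]
        constructor
        · rintro ⟨hs, hsV⟩
          have := congrFun h ⟨s, Finset.mem_union_right S hsV⟩
          rw [restrictBool_apply, restrictBool_apply] at this
          exact ⟨((@decide_eq_decide _ _ (Classical.propDecidable _) (Classical.propDecidable _)).1 this).1 hs, hsV⟩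
        · rintro ⟨hs, hsV⟩
          have := congrFun h ⟨s, Finset.mem_union_right S hsV⟩
          rw [restrictBool_apply, restrictBool_apply] at this
          exact ⟨((@decide_eq_decide _ _ (Classical.propDecidable _) (Classical.propDecidable _)).1 this).2 hs, hsV⟩
      have hĝA : ĝ A = ĝ A' := by rw [hĝloc A, hĝloc A', hVA]
      simp only [hB₂, Set.mem_setOf_eq, hĝA, hdet (ĝ A') hSA]
    have hB₂meas : MeasurableSet B₂ := hB₂det.measurableSet
    -- bound on `B₂`: the window lemma with the short window `S`, trivial background event
    set θ : ℝ≥0∞ :=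
      ENNReal.ofReal (1 / ((((4 * Polynomial.X ^ 3 : Polynomial ℕ).eval x.length : ℕ) : ℝ) + 1)) with hθ
    have hB₂le : randomOracleMeasure B₂ ≤ θ := by
      have hwin := measure_inter_le_of_window S (E := B₂) (F := Set.univ) (θ := θ) hB₂meas
        MeasurableSet.univ (fun A => by simp) (fun A₀ => ?_)
      · simpa using hwin
      -- per background: the stub-2 bound for the FIXED consistent `g = ĝ A₀` (or the empty set)
      rw [← randomOracleMeasure_patchFin_mem B₂ S A₀]
      by_cases hc : ((∀ v ∈ Q.yes, ĝ A₀ v = true) ∧ (∀ v ∈ Q.no, ĝ A₀ v = false))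
      · have hset : {A : Set (List Bool) | patchFin A₀ S (restrictBool S A) ∈ B₂} = badWith F C q x (ĝ A₀) := by
          ext A
          simp only [hB₂, Set.mem_setOf_eq, hĝpatch]
          rw [hdet (ĝ A₀) (restrictBool_patchFin A₀ S (restrictBool S A))]
          exact ⟨fun h => h.2, fun h => ⟨hc, h⟩⟩
        rw [hset]
        exact hC x hx (ĝ A₀) hc.1 hc.2
      · have hset : {A : Set (List Bool) | patchFin A₀ S (restrictBool S A) ∈ B₂} = ∅ := by
          ext A
          simp only [hB₂, Set.mem_setOf_eq, hĝpatch, Set.mem_empty_iff_false, iff_false, not_and]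
          exact fun h => absurd h hc
        rw [hset, measure_empty]
        exact bot_le
    -- arithmetic: `1/(2n³+1) + 1/(4n³+1) < 1/n³`
    set n : ℕ := x.length with hn
    have h2 : ((2 * Polynomial.X ^ 3 : Polynomial ℕ).eval n : ℕ) = 2 * n ^ 3 := by
      simp [Polynomial.eval_mul, Polynomial.eval_pow, Polynomial.eval_X]
    have h4 : ((4 * Polynomial.X ^ 3 : Polynomial ℕ).eval n : ℕ) = 4 * n ^ 3 := by
      simp [Polynomial.eval_mul, Polynomial.eval_pow, Polynomial.eval_X]
    have hn1 : (1 : ℝ) ≤ n := by exact_mod_cast hx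
    have hN : (1 : ℝ) ≤ (n : ℝ) ^ 3 := one_le_pow₀ hn1
    have hreal : 1 / ((((2 * n ^ 3 : ℕ)) : ℝ) + 1) + 1 / ((((4 * n ^ 3 : ℕ)) : ℝ) + 1) < 1 / (n : ℝ) ^ 3 := by
      push_cast
      rw [div_add_div _ _ (by positivity) (by positivity), div_lt_div_iff₀ (by positivity) (by positivity)]
      nlinarith [hN]
    calc randomOracleMeasure (badEvent F C' q' x)
        ≤ randomOracleMeasure (B₁ ∪ B₂) := measure_mono hsub
      _ ≤ randomOracleMeasure B₁ + randomOracleMeasure B₂ := measure_union_le _ _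
      _ ≤ ENNReal.ofReal (1 / ((((2 * n ^ 3 : ℕ)) : ℝ) + 1)) + ENNReal.ofReal (1 / ((((4 * n ^ 3 : ℕ)) : ℝ) + 1)) := by
          refine add_le_add ?_ ?_
          · rw [← h2]; exact hB₁le
          · rw [← h4]; exact hB₂le
      _ = ENNReal.ofReal (1 / ((((2 * n ^ 3 : ℕ)) : ℝ) + 1) + 1 / ((((4 * n ^ 3 : ℕ)) : ℝ) + 1)) :=
          (ENNReal.ofReal_add (by positivity) (by positivity)).symm
      _ < ENNReal.ofReal (1 / (n : ℝ) ^ 3) := by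
          rw [ENNReal.ofReal_lt_ofReal_iff (by positivity)]
          exact hreal
  exact key


/-! ## The UNCONDITIONAL bounded-query transfer -/

/-- **`BQP^{A[T₀]} ⊆ AvgP^A` almost surely, given `PromiseBQP ⊆ PromiseBPP'` — NO influence conjecture.**  For every `T₀`:
if `PromiseBQP ⊆ PromiseBPP'` then, for almost every random oracle `A`, every language decided with bounded error relative
to `A` by a uniform Clifford+T oracle family whose circuits make at most `T₀` oracle queries lies in `AvgP^A`
(`SimTreePB.oracleSimulationAt_of_boundedQueries` — DFKO through the circuit→query bridge and the per-family machine chain —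
fed to the class-restricted glue).  The `O(1)`-query shadow of Aaronson–Ambainis' Thm. 26 (`BQP^{A[log]}`, which they prove
under `P = P^{#P}`) in the tree's promise-transfer form; route RandomOracleGauge's support item `LogQueryTransfer`
(stmt-1131's sibling stmt-1155) asks for `c·log n + c` oracle gates, which needs a machine budget with an `n`-dependent dyadic
constant and is NOT claimed here. [cite: AaronsonAmbainis2014, Thm. 26 and Thm. 23] [cite: DinurEtAl2007, Thm. 3] -/
theorem ae_boundedQuery_subset_AvgPRel (T₀ : ℕ)
    (hPr : Literature.Computability.Cryptography.PromiseBQP ⊆ Literature.Computability.Complexity.PromiseBPP') :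
    ∀ᵐ A ∂randomOracle,
      {L : Language Bool | ∃ F : QCircuitFamily cliffordT, F.IsUniform ∧ (∀ n, (F.circ n).oracleQueries ≤ T₀) ∧
          ∀ x, (x ∈ L → 2 / 3 ≤ F.acceptProbOn (A : Language Bool) x) ∧ (x ∉ L → F.acceptProbOn A x ≤ 1 / 3)} ⊆
        Literature.Computability.Complexity.AvgPRel (Oracle.ofLanguage (A : Language Bool)) :=
  ae_subset_AvgPRel_of_simulationOn (fun F => ∀ n, (F.circ n).oracleQueries ≤ T₀)
    (fun F₀ hP => SimTreePB.oracleSimulationAt_of_boundedQueries T₀ F₀ hP) stub_promiseOracleElimination hPr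

/-- **All constant query bounds at once** (`T₀` ranges over `ℕ`, a countable intersection): given `PromiseBQP ⊆ PromiseBPP'`,
almost surely `BQP^{A[O(1)]} ⊆ AvgP^A`. [cite: AaronsonAmbainis2014, Thm. 26] -/
theorem ae_forall_boundedQuery_subset_AvgPRel
    (hPr : Literature.Computability.Cryptography.PromiseBQP ⊆ Literature.Computability.Complexity.PromiseBPP') :
    ∀ᵐ A ∂randomOracle, ∀ T₀ : ℕ,
      {L : Language Bool | ∃ F : QCircuitFamily cliffordT, F.IsUniform ∧ (∀ n, (F.circ n).oracleQueries ≤ T₀) ∧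
          ∀ x, (x ∈ L → 2 / 3 ≤ F.acceptProbOn (A : Language Bool) x) ∧ (x ∉ L → F.acceptProbOn A x ≤ 1 / 3)} ⊆
        Literature.Computability.Complexity.AvgPRel (Oracle.ofLanguage (A : Language Bool)) := by
  rw [ae_all_iff]
  exact fun T₀ => ae_boundedQuery_subset_AvgPRel T₀ hPr

end TransferPBGlue

end Summit.QuantumAdvantage.QuantumAdvantage.Theorems.SosSandwich

end
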